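import Literature.ComputerArithmetic.FloatingPoint.Formats
import Summits.Ventures.CertifiedArithmetic.LowPrec.SRBridge
import Summits.Ventures.CertifiedArithmetic.LowPrec.SRCertificatesFP4
import Summits.Ventures.CertifiedArithmetic.LowPrec.SRCertificatesFP6FP8
import HarnessLib

/-!
# Bridge: the SR value-set literals are the value sets of the `MiniFloat` substrate

HONEST FRAMING: certified error envelopes and provably optimal rounding/accumulation schemes for
low-precision formats under stated cost models; every table by two implementations; no hardware or
vendor claims.

The SR files state their envelopes over explicit `Finset ℚ` literals (`SR.FP4.e2m1`,
`SR.Formats.e3m2/e2m3/e4m3/e5m2`, generated by the cell's two independent Python implementations,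
which agree).  The lean seat's substrate (`Literature.ComputerArithmetic.FloatingPoint.MiniFloat`,
`Formats`) enumerates the finite data of a format structurally, and `SRBridge` defines
`MiniFloat.valueSet φ = Finset.univ.image toRat` (over which the CHM candidates are identified with the
format's directed roundings).  This file proves the list form
`MiniFloat.valueSet φ = ((MiniFloat.all φ).map toRat).toFinset` (kernel-reducible) and certifies BY
KERNEL DECISION that the five literals coincide with `MiniFloat.valueSet Format.E2M1 / E3M2 / E2M3 /
E4M3 / E5M2` — a third, structural, implementation of the value sets (for E5M2/E4M3: the finite part;
infinities/NaN are not data of `MiniFloat`).  Consequently every SR envelope stated over the literals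
holds verbatim for the substrate formats and composes with `SRBridge`'s rounding lemmas
(`valueSet_E2M1_accVar_le` etc. below are the restatements provers should cite).
-/

namespace Summit.Ventures.CertifiedArithmetic.LowPrec.SR

open Literature.ComputerArithmetic.FloatingPoint

/-- List form of the substrate value set (kernel-reducible): `MiniFloat.valueSet φ` is the finset of
the values of the structural enumeration `MiniFloat.all φ`. -/
theorem miniFloat_valueSet_eq (φ : Format) :
    MiniFloat.valueSet φ = ((MiniFloat.all φ).map MiniFloat.toRat).toFinset := by
  ext q
  rw [MiniFloat.mem_valueSet, List.mem_toFinset, List.mem_map]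
  constructor
  · rintro ⟨x, hx⟩; exact ⟨x, MiniFloat.mem_all x, hx⟩
  · rintro ⟨x, _, hx⟩; exact ⟨x, hx⟩

/-- **E2M1**: the FP4 literal equals the substrate value set (kernel decision). -/
theorem e2m1_eq_valueSet : FP4.e2m1 = MiniFloat.valueSet Format.E2M1 := by
  rw [miniFloat_valueSet_eq]; decide +kernel

/-- **E3M2**: the FP6 literal equals the substrate value set (kernel decision). -/
theorem e3m2_eq_valueSet : Formats.e3m2 = MiniFloat.valueSet Format.E3M2 := by
  rw [miniFloat_valueSet_eq]; decide +kernel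

/-- **E2M3**: the FP6 literal equals the substrate value set (kernel decision). -/
theorem e2m3_eq_valueSet : Formats.e2m3 = MiniFloat.valueSet Format.E2M3 := by
  rw [miniFloat_valueSet_eq]; decide +kernel

/-- **E4M3** (OCP, finite data; the NaN encodings are not data): the FP8 literal equals the substrate
value set (kernel decision). -/
theorem e4m3_eq_valueSet : Formats.e4m3 = MiniFloat.valueSet Format.E4M3 := by
  rw [miniFloat_valueSet_eq]; decide +kernel

/-- **E5M2** (OCP, finite data; ±∞/NaN are not data): the FP8 literal equals the substrate value set
(kernel decision). -/
theorem e5m2_eq_valueSet : Formats.e5m2 = MiniFloat.valueSet Format.E5M2 := by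
  rw [miniFloat_valueSet_eq]; decide +kernel

/-! ### The SR envelopes restated over the substrate formats -/

/-- SR recursive summation of E2M1 data into E2M1 (from `0`): `Var ŝₙ ≤ n` (pair table: one-step
variance `≤ 1`). -/
theorem valueSet_E2M1_accVar_le (x : ℕ → ℚ) (hx : ∀ i, x i ∈ MiniFloat.valueSet Format.E2M1) (n : ℕ) :
    accVar (MiniFloat.valueSet Format.E2M1) x n 0 ≤ n := by
  rw [← e2m1_eq_valueSet] at hx ⊢; exact FP4.fp4_accVar_le x hx n

/-- The same for data given as `MiniFloat Format.E2M1` streams. -/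
theorem miniFloat_E2M1_accVar_le (x : ℕ → MiniFloat Format.E2M1) (n : ℕ) :
    accVar (MiniFloat.valueSet Format.E2M1) (fun i => (x i).toRat) n 0 ≤ n :=
  valueSet_E2M1_accVar_le _ (fun i => MiniFloat.toRat_mem_valueSet (x i)) n

/-- SR recursive summation into E3M2: `Var ŝₙ ≤ 4n`. -/
theorem valueSet_E3M2_accVar_le (x : ℕ → ℚ) (n : ℕ) (s : ℚ) :
    accVar (MiniFloat.valueSet Format.E3M2) x n s ≤ n * 4 := by
  rw [← e3m2_eq_valueSet]; exact Formats.e3m2_accVar_le x n s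

/-- SR recursive summation into E2M3: `Var ŝₙ ≤ n/16`. -/
theorem valueSet_E2M3_accVar_le (x : ℕ → ℚ) (n : ℕ) (s : ℚ) :
    accVar (MiniFloat.valueSet Format.E2M3) x n s ≤ n * 1 / 16 := by
  rw [← e2m3_eq_valueSet]; exact Formats.e2m3_accVar_le x n s

/-- SR recursive summation into E4M3 (saturating at ±448): `Var ŝₙ ≤ 256 n`. -/
theorem valueSet_E4M3_accVar_le (x : ℕ → ℚ) (n : ℕ) (s : ℚ) :
    accVar (MiniFloat.valueSet Format.E4M3) x n s ≤ n * 256 := by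
  rw [← e4m3_eq_valueSet]; exact Formats.e4m3_accVar_le x n s

/-- SR recursive summation into E5M2 (finite part, saturating at ±57344): `Var ŝₙ ≤ 2²⁴ n`. -/
theorem valueSet_E5M2_accVar_le (x : ℕ → ℚ) (n : ℕ) (s : ℚ) :
    accVar (MiniFloat.valueSet Format.E5M2) x n s ≤ n * 16777216 := by
  rw [← e5m2_eq_valueSet]; exact Formats.e5m2_accVar_le x n s

/-- Unbiasedness on the substrate formats (any `φ`): with no saturation along the way,
`E ŝₙ = s + ∑ xᵢ` — this is `accExp_id_of_noSat` and needs no bridge; recorded for citation. -/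
theorem valueSet_accExp_id_of_noSat (φ : Format) (x : ℕ → ℚ) (n : ℕ) (s : ℚ)
    (h : NoSat (MiniFloat.valueSet φ) x n s) :
    accExp (MiniFloat.valueSet φ) x n (fun t => t) s = s + ∑ i ∈ Finset.range n, x i :=
  accExp_id_of_noSat (MiniFloat.valueSet φ) x n s h

end Summit.Ventures.CertifiedArithmetic.LowPrec.SR
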